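import Mathlib
import HarnessLib
import Summits.Langlands.Statement
import Summits.Langlands.Langlands.Theses.DepthPrimeSplit
import Summits.Langlands.Langlands.Theses.PrimeSwitchSplit
import Summits.Langlands.Langlands.Theorems.TransientLevelSplitLevelFiniteness
import Literature.NumberTheory.Automorphic.JacquetLanglandsParts

/-!
# BoxCaptureSplit — decomp-langlands lens-3 («one certified translation + split beneath»), gen 34, RESIDUAL MODE

TARGET (by name): CLASS = `Summit.Langlands.Langlands.Theses.DepthPrimeSplit.Classicality` (stmt-Langlands-25026, crux r5 of
route-Langlands-DepthPrimeSplit; the registered blocker that the FERN lineage g29–g33 consumes «modulo registered CLASS»):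
«an irreducible pinned-geometric `ρ` that is PRO-AUTOMORPHIC OF BOUNDED LEVEL (C: one finite `S`, to every ℓ-adic depth `r` some
L-algebraic cuspidal `π_r` coefficientwise `r`-close to `ρ` at every `v ∉ S`) is WEAKLY AUTOMORPHIC».

THE ONE EQUIV (kernel, modulo NOTHING, with content): CLASS ⟺ CAP := Frame(C → CAPTURED), where CAPTURED BY A FINITE MENU
(`IsFinitelyCaptured`, new) says: ONE finite `S` and ONE FINITE MENU `(π_1, α_1), …, (π_k, α_k)` of L-algebraic cuspidal representations
WITH THEIR SATAKE DATA off `S` such that to every depth SOME MENU MEMBER is `r`-close to `ρ` off `S`.  Certified by `weakly_iff_captured`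
(pigeonhole over the menu along the depths `2^{-m}` + monotonicity in the radius + Archimedes: a coefficient of valuation `< 2^{-m}` for
every `m` vanishes) — the single-member, exchange-free end of gen 30's dictionary, now stated for MENUS.
Dictionary (second language = the (CONDUCTOR, INFINITY-TYPE) BOXES of the cuspidal spectrum, Harish-Chandra / Borel–Jacquet 4.3(i)):
  weakly automorphic ↔ captured by a finite menu (kernel) · «the weight of ρ is ATTAINED, not only approached» ↔ WT · «the wild level of the
  approximants can be bounded» ↔ LEV · «a box holds finitely many cuspidal π» ↔ HC (Harish-Chandra finiteness, LANGLANDS-FREE).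
Two MEMBER-LEVEL DATA enter the currency for the first time (gen 33 NEXT-g34 #4 asked for exactly such a datum): the CONDUCTOR
(`HasLevel π 𝔫`: a non-zero `K(𝔫)`-fixed vector, the clause inside the accepted `HasSatakeParamAt`) and the INFINITY TYPE
(accepted `AutomorphicRepData.HasInfinityType (T : InfinityType K n)`).

SPLIT BENEATH (exact AND, seams trivial, every piece ROOT-IMPLIED — `cells_of_langlands`): CAP ⟺ LEV ∧ WT ∧ HC (`capture_iff_cells`),
hence CLASS ⟺ LEV ∧ WT ∧ HC (`classicality_iff_cells`), along the ladder  C ⟸ C^lev ⟸ C^box ⟸ CAPTURED ⟺ WA: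
* LEV `LevelIsolation` (crux r3 · WEAKER · IDEA-NEEDED / PRINT-mod-(A)+LGC): C → C^lev «the approximants may be taken of BOUNDED CONDUCTOR
  (levels in a finite set), in particular of bounded wild level at `v ∣ ℓ` and at the other places of `S`».
* WT `WeightIsolation` (crux r2 · WEAKER · THE classicality content; PRINT GL₂/ℚ, OPEN-CONJECTURE polarised n ≥ 3, BARRIER irregular):
  C^lev → C^box «… and with infinity types in a FINITE set» (de Rham ⟹ the weight is attained: Kisin 2003, Emerton 2011 Thm 1.2.4, Pan 2022
  = tree fact `Pan2022_proModularDeRhamClassical_GL2Q`; Breuil–Hellmann–Schraen 2019; `Literature.Barriers.Langlands.NonRegularWeightBarrier`).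
* HC `HarishChandraCapture` (support r4 · WEAKER · PRINT · LANGLANDS-FREE · ATTACKABLE-NOW modulo the accepted hypothesis structure
  `AutomorphyDatum.HasFiniteness` = Borel–Jacquet 4.3(i), Harish-Chandra LNM 62 Thm 1): C^box → CAPTURED «a (conductor, type)-box of the
  cuspidal spectrum of `GL_n/K` is finite up to Satake data, so boxed approximants to every depth come from ONE finite menu».
Frames BY NAME: `closes_classicality : LEV → WT → HC → DepthPrimeSplit.Classicality`, `closes_root` through the tree's `DepthPrimeSplit.closes`.
WHY NOVEL: the first node in which the WEIGHT and the CONDUCTOR of the approximants are typed; classicality is factored as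
LEVEL ISOLATION ∧ WEIGHT ISOLATION ∧ HARISH-CHANDRA FINITENESS, the last being a Langlands-free theorem in print — an alternative (mechanism)
decomposition of node 25026, orthogonal to lens-2's population cut by Hodge–Tate multiplicity (`DepthPrimeSplitClassicalityWeight`).
-/

set_option linter.dupNamespace false
set_option linter.unusedVariables false

namespace Summit.Langlands.Langlands.Theorems.BoxCapture

open scoped NumberField Classical -- `Classical`: the place subtypes indexing `mixedSpace K` are `Fintype` classically (`NormedCommRing (mixedSpace K)`, needed to write `rightTranslation (AdelicGroupData.gl n K)`)
open Filter Field IsDedekindDomain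
open Literature.NumberTheory.GaloisRepresentations Literature.NumberTheory.Automorphic
open Summit.Langlands.Langlands.Theorems.TransientLevel
open Summit.Langlands.Langlands.Theses

/-! ## 1. Vocabulary (C, WA, `CloseAt`, `IsPinnedGeometric` are the tree's `Theorems.TransientLevel` ones, BY NAME) -/

section Vocabulary

variable {K : Type} [Field K] [NumberField K] {n : ℕ} {ℓ : ℕ} [Fact ℓ.Prime]

/-- CONDUCTOR DATUM · `π` has LEVEL `𝔫`: `𝔫 ≠ 0` and some form `φ ∈ W ∖ W'` is fixed by the principal congruence subgroup `K(𝔫)`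
(the clause inside the accepted `HasSatakeParamAt`; Jacquet–Piatetski-Shapiro–Shalika: the conductor of `π` divides such an `𝔫`). -/
def HasLevel {hcpt : isCompact_glFiniteIntegralLevel n K} (π : CuspidalAutomorphicRepData n K hcpt) (𝔫 : Ideal (𝓞 K)) : Prop :=
  𝔫 ≠ 0 ∧ ∃ φ ∈ π.1.W, φ ∉ π.1.W' ∧ ∀ u ∈ principalCongruenceLevel n K 𝔫, rightTranslation (AdelicGroupData.gl n K) u φ = φ

/-- BOX MEMBERSHIP · `π` lies in the (conductor, infinity-type) box `(𝔑, 𝒯)`: its level is in `𝔑` and one of its infinity types is in `𝒯`. -/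
def InBox {hcpt : isCompact_glFiniteIntegralLevel n K} (𝔑 : Set (Ideal (𝓞 K))) (𝒯 : Set (InfinityType K n))
    (π : CuspidalAutomorphicRepData n K hcpt) : Prop :=
  (∃ 𝔫 ∈ 𝔑, HasLevel π 𝔫) ∧ ∃ T ∈ 𝒯, π.1.HasInfinityType T

/-- Closeness at `v` to depth `r` with a PINNED Satake datum `α v` (the second half of the tree's `CloseAt`). -/
def CloseWith (ι : PadicAlgCl ℓ ≃+* ℂ) (ρ : FramedGaloisRep K (PadicAlgCl ℓ) n) (α : HeightOneSpectrum (𝓞 K) → Multiset ℂ)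
    (r : NNReal) (v : HeightOneSpectrum (𝓞 K)) : Prop :=
  ∀ 𝔓 ∈ v.primesAbove, ∀ σ : absoluteGaloisGroup K, IsArithFrobAt (𝓞 K) σ 𝔓 →
    ∀ i : ℕ, Valued.v ((FramedRep.charpoly ρ σ - arithFrobPolyOfSatake ι v.residueCard 1 (α v)).coeff i) < r

/-- C^lev · PRO-AUTOMORPHIC OF BOUNDED CONDUCTOR: ONE finite `S` and ONE finite set `𝔑` of levels such that to every depth `r` some
L-algebraic cuspidal `π_r` OF LEVEL IN `𝔑` is `r`-close to `ρ` at every `v ∉ S` (C bounds only the set of bad places, not the level there). -/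
def IsLevelBoundedProAutomorphic (hcpt : isCompact_glFiniteIntegralLevel n K) (ι : PadicAlgCl ℓ ≃+* ℂ)
    (ρ : FramedGaloisRep K (PadicAlgCl ℓ) n) : Prop :=
  ∃ S : Set (HeightOneSpectrum (𝓞 K)), S.Finite ∧ ∃ 𝔑 : Set (Ideal (𝓞 K)), 𝔑.Finite ∧ ∀ r : NNReal, 0 < r →
    ∃ π : CuspidalAutomorphicRepData n K hcpt, π.1.IsLAlgebraic ∧ (∃ 𝔫 ∈ 𝔑, HasLevel π 𝔫) ∧
      ∀ v : HeightOneSpectrum (𝓞 K), v ∉ S → CloseAt ι π ρ r v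

/-- C^box · BOXED PRO-AUTOMORPHIC: ONE finite `S` and ONE (conductor, infinity-type) box `(𝔑, 𝒯)`, both finite, containing, to every depth
`r`, an L-algebraic cuspidal `π_r` that is `r`-close to `ρ` at every `v ∉ S`. -/
def IsBoxedProAutomorphic (hcpt : isCompact_glFiniteIntegralLevel n K) (ι : PadicAlgCl ℓ ≃+* ℂ)
    (ρ : FramedGaloisRep K (PadicAlgCl ℓ) n) : Prop :=
  ∃ S : Set (HeightOneSpectrum (𝓞 K)), S.Finite ∧ ∃ 𝔑 : Set (Ideal (𝓞 K)), 𝔑.Finite ∧ ∃ 𝒯 : Set (InfinityType K n), 𝒯.Finite ∧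
    ∀ r : NNReal, 0 < r → ∃ π : CuspidalAutomorphicRepData n K hcpt, π.1.IsLAlgebraic ∧ InBox 𝔑 𝒯 π ∧
      ∀ v : HeightOneSpectrum (𝓞 K), v ∉ S → CloseAt ι π ρ r v

/-- CAPTURED BY A FINITE MENU (the second language of the EQUIV): ONE finite `S` and ONE finite menu `(π_j, α_j)_{j<k}` of L-algebraic
cuspidal representations with their Satake data off `S` such that to every depth `r` SOME MENU MEMBER is `r`-close to `ρ` off `S`. -/
def IsFinitelyCaptured (hcpt : isCompact_glFiniteIntegralLevel n K) (ι : PadicAlgCl ℓ ≃+* ℂ)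
    (ρ : FramedGaloisRep K (PadicAlgCl ℓ) n) : Prop :=
  ∃ S : Set (HeightOneSpectrum (𝓞 K)), S.Finite ∧
    ∃ (k : ℕ) (π : Fin k → CuspidalAutomorphicRepData n K hcpt) (α : Fin k → HeightOneSpectrum (𝓞 K) → Multiset ℂ),
      (∀ j : Fin k, (π j).1.IsLAlgebraic ∧ ∀ v : HeightOneSpectrum (𝓞 K), v ∉ S → (π j).1.HasSatakeParamAt v (α j v)) ∧
      ∀ r : NNReal, 0 < r → ∃ j : Fin k, ∀ v : HeightOneSpectrum (𝓞 K), v ∉ S → CloseWith ι ρ (α j) r v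

end Vocabulary

/-! ## 2. The items (Frame = CLASS's binders and hypotheses VERBATIM; one-liners of record in memo.md §2) -/

/-- CAP · CAPTURE CLASSICALITY — the EQUIV'd form of CLASS (`classicality_iff_capture`): pro-automorphic of bounded level ⟹ captured by a
finite menu.  Not an item of the split (it IS the target in the second language). -/
def CaptureClassicality : Prop :=
  ∀ (K : Type) [Field K] [NumberField K] (n : ℕ) (hcpt : isCompact_glFiniteIntegralLevel n K), 0 < n →
    ∀ (ℓ : ℕ) [Fact ℓ.Prime] (ι : PadicAlgCl ℓ ≃+* ℂ) (ρ : FramedGaloisRep K (PadicAlgCl ℓ) n),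
      ρ.toGaloisRep.IsIrreducible → IsPinnedGeometric ρ → IsProAutomorphic hcpt ι ρ → IsFinitelyCaptured hcpt ι ρ

/-- LEV · LEVEL ISOLATION · crux rank 3 · WEAKER · IDEA-NEEDED (PRINT modulo (A)+local–global compatibility for the approximants).
Pro-automorphic of bounded level ⟹ pro-automorphic of bounded CONDUCTOR: along an ℓ-adically convergent sequence of cuspidal `π_r` the
level at the places of `S` (including `v ∣ ℓ`) can be bounded.  Why it might fail: the currency sees `π_r` only through Satake data off `S`;
bounding its conductor needs the Galois representations of the approximants (Swan conductor is residual: Serre; wild inertial type rigid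
beyond depth `1/(ℓ-1)`), i.e. (A)+LGC for `π_r`, or a purely automorphic substitute (Coleman families give level `Np` approximants of
finite-slope points). -/
def LevelIsolation : Prop :=
  ∀ (K : Type) [Field K] [NumberField K] (n : ℕ) (hcpt : isCompact_glFiniteIntegralLevel n K), 0 < n →
    ∀ (ℓ : ℕ) [Fact ℓ.Prime] (ι : PadicAlgCl ℓ ≃+* ℂ) (ρ : FramedGaloisRep K (PadicAlgCl ℓ) n),
      ρ.toGaloisRep.IsIrreducible → IsPinnedGeometric ρ → IsProAutomorphic hcpt ι ρ → IsLevelBoundedProAutomorphic hcpt ι ρ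

/-- WT · WEIGHT ISOLATION · crux rank 2 · WEAKER · the classicality content proper (de Rham ⟹ the weight is ATTAINED by the approximants,
not only ℓ-adically approached).  PRINT for GL₂/ℚ (Kisin 2003; Emerton 2011 Thm 1.2.4; Pan 2022, tree fact
`Pan2022_proModularDeRhamClassical_GL2Q`, any `p`, residually absolutely irreducible), Hilbert T-regular (Jiang), polarisable
crystalline-generic GL_n (Breuil–Hellmann–Schraen 2019); OPEN-CONJECTURE in general; BARRIER `NonRegularWeightBarrier` for irregular
Hodge–Tate type in rank ≥ 3.  Why it might fail: an irregular de Rham limit of regular-weight forms need not be congruent to deep depth to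
forms of finitely many weights at bounded level (companion-form / weight-cycling phenomena beyond GL₂). -/
def WeightIsolation : Prop :=
  ∀ (K : Type) [Field K] [NumberField K] (n : ℕ) (hcpt : isCompact_glFiniteIntegralLevel n K), 0 < n →
    ∀ (ℓ : ℕ) [Fact ℓ.Prime] (ι : PadicAlgCl ℓ ≃+* ℂ) (ρ : FramedGaloisRep K (PadicAlgCl ℓ) n),
      ρ.toGaloisRep.IsIrreducible → IsPinnedGeometric ρ → IsLevelBoundedProAutomorphic hcpt ι ρ → IsBoxedProAutomorphic hcpt ι ρ

/-- HC · HARISH-CHANDRA CAPTURE · support rank 4 · WEAKER · PRINT · LANGLANDS-FREE · ATTACKABLE-NOW modulo the accepted hypothesis structure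
`AutomorphyDatum.HasFiniteness` (Borel–Jacquet 1979, 4.3(i); Harish-Chandra, LNM 62, Thm 1: `dim 𝒜₀(K(𝔫), J, τ) < ∞`, and finitely
many irreducible `(𝔤, K_∞)`-modules with a given infinitesimal character): a finite (conductor, infinity-type) box holds finitely many
cuspidal automorphic representations up to Satake data, so boxed approximants to every depth are drawn from ONE finite menu.  Why it might
fail: only if the tree's `AutomorphicRepData` admitted box members with exotic Satake data (it does not: `W / W'` is irreducible). -/
def HarishChandraCapture : Prop :=
  ∀ (K : Type) [Field K] [NumberField K] (n : ℕ) (hcpt : isCompact_glFiniteIntegralLevel n K), 0 < n →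
    ∀ (ℓ : ℕ) [Fact ℓ.Prime] (ι : PadicAlgCl ℓ ≃+* ℂ) (ρ : FramedGaloisRep K (PadicAlgCl ℓ) n),
      ρ.toGaloisRep.IsIrreducible → IsPinnedGeometric ρ → IsBoxedProAutomorphic hcpt ι ρ → IsFinitelyCaptured hcpt ι ρ

/-- The optional ASSEMBLY item: LEV → WT → HC → CLASS (proved: `boxAssembly_proof`; named `BoxAssembly` — the bare name `Assembly` is registry-owned). -/
def BoxAssembly : Prop :=
  LevelIsolation → WeightIsolation → HarishChandraCapture → DepthPrimeSplit.Classicality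

/-! ## 3. Kernel -/

section Kernel

variable {K : Type} [Field K] [NumberField K] {n : ℕ} {ℓ : ℕ} [Fact ℓ.Prime]
  {hcpt : isCompact_glFiniteIntegralLevel n K} {ι : PadicAlgCl ℓ ≃+* ℂ} {ρ : FramedGaloisRep K (PadicAlgCl ℓ) n}

/-- `CloseAt` = a Satake datum + `CloseWith` (definitional). -/
theorem closeAt_iff_exists_closeWith {π : CuspidalAutomorphicRepData n K hcpt} {r : NNReal} {v : HeightOneSpectrum (𝓞 K)} :
    CloseAt ι π ρ r v ↔ ∃ α : Multiset ℂ, π.1.HasSatakeParamAt v α ∧ CloseWith ι ρ (fun _ => α) r v :=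
  Iff.rfl

/-- `CloseWith` is monotone in the radius. -/
theorem closeWith_mono {α : HeightOneSpectrum (𝓞 K) → Multiset ℂ} {r r' : NNReal} (hrr' : r ≤ r') {v : HeightOneSpectrum (𝓞 K)}
    (h : CloseWith ι ρ α r v) : CloseWith ι ρ α r' v :=
  fun 𝔓 h𝔓 σ hσ i => (h 𝔓 h𝔓 σ hσ i).trans_le hrr'

/-- A level can be read off ANY Satake datum (the accepted `HasSatakeParamAt` carries a `K(𝔫)`-fixed form `φ ∈ W ∖ W'`). -/
theorem hasLevel_of_hasSatakeParamAt {π : CuspidalAutomorphicRepData n K hcpt} {v : HeightOneSpectrum (𝓞 K)} {α : Multiset ℂ}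
    (h : π.1.HasSatakeParamAt v α) : ∃ 𝔫 : Ideal (𝓞 K), HasLevel π 𝔫 := by
  obtain ⟨𝔫, ϖ, h𝔫, _hv, _hϖ, _hcard, φ, hφW, hφW', hfix, _heig⟩ := h
  exact ⟨𝔫, h𝔫, φ, hφW, hφW', hfix⟩

/-- Every L-algebraic `π` has an infinity type (definitional unpacking of the accepted `IsLAlgebraic`). -/
theorem exists_infinityType_of_isLAlgebraic {π : CuspidalAutomorphicRepData n K hcpt} (h : π.1.IsLAlgebraic) :
    ∃ T : InfinityType K n, π.1.HasInfinityType T := by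
  obtain ⟨T, hT, _⟩ := h
  exact ⟨T, hT⟩

/-- DOWN THE LADDER (1): captured ⟹ boxed.  The menu's levels (read at one place off `S`, which exists because `K` has infinitely many
finite places) and infinity types form a finite box. -/
theorem boxed_of_captured (h : IsFinitelyCaptured hcpt ι ρ) : IsBoxedProAutomorphic hcpt ι ρ := by
  classical
  obtain ⟨S, hS, k, π, α, hmenu, hdepth⟩ := h
  haveI : Infinite (HeightOneSpectrum (𝓞 K)) := infinite_heightOneSpectrum K
  obtain ⟨v₀, hv₀⟩ : ∃ v₀ : HeightOneSpectrum (𝓞 K), v₀ ∉ S := hS.infinite_compl.nonempty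
  have hlev : ∀ j : Fin k, ∃ 𝔫 : Ideal (𝓞 K), HasLevel (π j) 𝔫 := fun j => hasLevel_of_hasSatakeParamAt ((hmenu j).2 v₀ hv₀)
  have htyp : ∀ j : Fin k, ∃ T : InfinityType K n, (π j).1.HasInfinityType T := fun j => exists_infinityType_of_isLAlgebraic (hmenu j).1
  choose 𝔫 h𝔫 using hlev
  choose T hT using htyp
  refine ⟨S, hS, Set.range 𝔫, Set.finite_range 𝔫, Set.range T, Set.finite_range T, fun r hr => ?_⟩
  obtain ⟨j, hj⟩ := hdepth r hr
  exact ⟨π j, (hmenu j).1, ⟨⟨𝔫 j, Set.mem_range_self j, h𝔫 j⟩, T j, Set.mem_range_self j, hT j⟩,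
    fun v hv => ⟨α j v, (hmenu j).2 v hv, hj v hv⟩⟩

/-- DOWN THE LADDER (2): boxed ⟹ bounded conductor (forget the infinity types). -/
theorem levelBounded_of_boxed (h : IsBoxedProAutomorphic hcpt ι ρ) : IsLevelBoundedProAutomorphic hcpt ι ρ := by
  obtain ⟨S, hS, 𝔑, h𝔑, 𝒯, _h𝒯, h⟩ := h
  refine ⟨S, hS, 𝔑, h𝔑, fun r hr => ?_⟩
  obtain ⟨π, hπ, hbox, hclose⟩ := h r hr
  exact ⟨π, hπ, hbox.1, hclose⟩

/-- DOWN THE LADDER (3): bounded conductor ⟹ bounded level (forget the conductor: C, the target's hypothesis). -/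
theorem pro_of_levelBounded (h : IsLevelBoundedProAutomorphic hcpt ι ρ) : IsProAutomorphic hcpt ι ρ := by
  obtain ⟨S, hS, _𝔑, _h𝔑, h⟩ := h
  refine ⟨S, hS, fun r hr => ?_⟩
  obtain ⟨π, hπ, _hlev, hclose⟩ := h r hr
  exact ⟨π, hπ, hclose⟩

/-- captured ⟹ C. -/
theorem pro_of_captured (h : IsFinitelyCaptured hcpt ι ρ) : IsProAutomorphic hcpt ι ρ :=
  pro_of_levelBounded (levelBounded_of_boxed (boxed_of_captured h))

/-- THE TOP OF THE LADDER (easy half): weakly automorphic ⟹ captured, by the one-member menu of the compatible `π` with its compatible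
Satake data (the difference polynomial is `0`). -/
theorem captured_of_weakly (h : IsWeaklyAutomorphic hcpt ι ρ) : IsFinitelyCaptured hcpt ι ρ := by
  classical
  obtain ⟨π, hπ, hcof⟩ := h
  let S : Set (HeightOneSpectrum (𝓞 K)) := {v | ¬ SatakeFrobCompatibleAt ι π.1 ρ v}
  have hS : S.Finite := Filter.eventually_cofinite.mp hcof
  have hc : ∀ v : HeightOneSpectrum (𝓞 K), v ∉ S → SatakeFrobCompatibleAt ι π.1 ρ v := fun v hv => by
    by_contra h'
    exact hv h'
  let α : HeightOneSpectrum (𝓞 K) → Multiset ℂ := fun v => if hv : v ∉ S then Classical.choose (hc v hv) else 0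
  have hα : ∀ v (hv : v ∉ S), π.1.HasSatakeParamAt v (α v) ∧ ρ.IsUnramifiedAt v ∧
      ρ.HasFrobCharpolyAt v (arithFrobPolyOfSatake ι v.residueCard 1 (α v)) := fun v hv => by
    simp only [α, dif_pos hv]
    exact Classical.choose_spec (hc v hv)
  refine ⟨S, hS, 1, fun _ => π, fun _ => α, fun _ => ⟨hπ, fun v hv => (hα v hv).1⟩, fun r hr => ⟨0, fun v hv 𝔓 h𝔓 σ hσ i => ?_⟩⟩
  have e : FramedRep.charpoly ρ σ = arithFrobPolyOfSatake ι v.residueCard 1 (α v) := (hα v hv).2.2 𝔓 h𝔓 σ hσ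
  rw [e, sub_self, Polynomial.coeff_zero, map_zero]
  exact hr

/-- **THE CERTIFIED TRANSLATION (hard half): captured by a finite menu ⟹ weakly automorphic**, for an a.e.-unramified `ρ`.
Pigeonhole over the finite menu along the depths `2^{-m}` (monotonicity in the radius makes ONE member serve every `m`), then exactness:
a coefficient of valuation `< 2^{-m}` for every `m` is `0`, so that member is Satake–Frobenius compatible with `ρ` off `S ∪ Ram ρ`. -/
theorem weakly_of_captured (hur : ∀ᶠ v : HeightOneSpectrum (𝓞 K) in cofinite, ρ.IsUnramifiedAt v)
    (h : IsFinitelyCaptured hcpt ι ρ) : IsWeaklyAutomorphic hcpt ι ρ := by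
  classical
  obtain ⟨S, hS, k, π, α, hmenu, hdepth⟩ := h
  let S' : Set (HeightOneSpectrum (𝓞 K)) := S ∪ {v | ¬ ρ.IsUnramifiedAt v}
  have hS' : S'.Finite := hS.union (Filter.eventually_cofinite.mp hur)
  have hur' : ∀ v : HeightOneSpectrum (𝓞 K), v ∉ S' → ρ.IsUnramifiedAt v := fun v hv => by
    by_contra h'
    exact hv (Or.inr h')
  have hSS' : ∀ v : HeightOneSpectrum (𝓞 K), v ∉ S' → v ∉ S := fun v hv hvS => hv (Or.inl hvS)
  -- the radii t ^ m, t = 1/2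
  let t : NNReal := 2⁻¹
  have ht0 : 0 < t := by positivity
  have ht1 : t ≤ 1 := by rw [inv_le_one₀ (by positivity)]; norm_num
  have htlt : t < 1 := by rw [inv_lt_one₀ (by positivity)]; norm_num
  have hstep : ∀ m : ℕ, ∃ j : Fin k, ∀ v : HeightOneSpectrum (𝓞 K), v ∉ S' → CloseWith ι ρ (α j) (t ^ m) v := fun m => by
    obtain ⟨j, hj⟩ := hdepth (t ^ m) (pow_pos ht0 m)
    exact ⟨j, fun v hv => hj v (hSS' v hv)⟩
  choose j hj using hstep
  -- pigeonhole through monotonicity: ONE member serves every m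
  have hone : ∃ j₀ : Fin k, ∀ m : ℕ, ∀ v : HeightOneSpectrum (𝓞 K), v ∉ S' → CloseWith ι ρ (α j₀) (t ^ m) v := by
    by_contra H
    push Not at H
    choose m hm using H
    let M : ℕ := Finset.univ.sup m
    obtain ⟨v, hv, hfar⟩ := hm (j M)
    have h1 : CloseWith ι ρ (α (j M)) (t ^ M) v := hj M v hv
    have h2 : t ^ M ≤ t ^ m (j M) := pow_le_pow_right_of_le_one' ht1 (Finset.le_sup (Finset.mem_univ (j M)))
    exact hfar (closeWith_mono h2 h1)
  obtain ⟨j₀, hj₀⟩ := hone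
  refine ⟨π j₀, (hmenu j₀).1, Filter.eventually_cofinite.mpr (hS'.subset fun v hv => ?_)⟩
  by_contra hvS'
  apply hv
  refine ⟨α j₀ v, (hmenu j₀).2 v (hSS' v hvS'), hur' v hvS', fun 𝔓 h𝔓 σ hσ => ?_⟩
  refine sub_eq_zero.mp (Polynomial.ext fun i => ?_)
  rw [Polynomial.coeff_zero, ← (Valued.v : Valuation (PadicAlgCl ℓ) NNReal).zero_iff]
  -- a nonnegative real `< t ^ m` for every `m` is `0` (Archimedes)
  by_contra hne
  obtain ⟨m, hm⟩ := exists_pow_lt_of_lt_one (pos_iff_ne_zero.mpr hne) htlt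
  exact absurd (hj₀ m v hvS' 𝔓 h𝔓 σ hσ i) (not_lt.mpr hm.le)

/-- **THE DICTIONARY ENTRY:** weakly automorphic ⟺ captured by a finite menu (for an a.e.-unramified `ρ`). -/
theorem weakly_iff_captured (hur : ∀ᶠ v : HeightOneSpectrum (𝓞 K) in cofinite, ρ.IsUnramifiedAt v) :
    IsWeaklyAutomorphic hcpt ι ρ ↔ IsFinitelyCaptured hcpt ι ρ :=
  ⟨captured_of_weakly, weakly_of_captured hur⟩

/-- The whole ladder under weak automorphy (the constant family is a one-member menu, a box, a bounded conductor, a bounded level). -/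
theorem ladder_of_weakly (h : IsWeaklyAutomorphic hcpt ι ρ) :
    IsFinitelyCaptured hcpt ι ρ ∧ IsBoxedProAutomorphic hcpt ι ρ ∧ IsLevelBoundedProAutomorphic hcpt ι ρ ∧ IsProAutomorphic hcpt ι ρ :=
  ⟨captured_of_weakly h, boxed_of_captured (captured_of_weakly h), levelBounded_of_boxed (boxed_of_captured (captured_of_weakly h)),
    pro_of_captured (captured_of_weakly h)⟩

end Kernel

/-! ## 4. The EQUIV and the exact split -/

/-- **THE ONE EQUIV (modulo nothing): CLASS ⟺ CAP.** -/
theorem classicality_iff_capture : DepthPrimeSplit.Classicality ↔ CaptureClassicality :=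
  ⟨fun h K _ _ n hcpt hn ℓ _ ι ρ hirr hgeo hC => captured_of_weakly (h K n hcpt hn ℓ ι ρ hirr hgeo hC),
    fun h K _ _ n hcpt hn ℓ _ ι ρ hirr hgeo hC => weakly_of_captured hgeo.1 (h K n hcpt hn ℓ ι ρ hirr hgeo hC)⟩

/-- CAP ⟹ LEV. -/
theorem lev_of_capture (h : CaptureClassicality) : LevelIsolation :=
  fun K _ _ n hcpt hn ℓ _ ι ρ hirr hgeo hC => levelBounded_of_boxed (boxed_of_captured (h K n hcpt hn ℓ ι ρ hirr hgeo hC))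

/-- CAP ⟹ WT. -/
theorem wt_of_capture (h : CaptureClassicality) : WeightIsolation :=
  fun K _ _ n hcpt hn ℓ _ ι ρ hirr hgeo hL => boxed_of_captured (h K n hcpt hn ℓ ι ρ hirr hgeo (pro_of_levelBounded hL))

/-- CAP ⟹ HC. -/
theorem hc_of_capture (h : CaptureClassicality) : HarishChandraCapture :=
  fun K _ _ n hcpt hn ℓ _ ι ρ hirr hgeo hB => h K n hcpt hn ℓ ι ρ hirr hgeo (pro_of_levelBounded (levelBounded_of_boxed hB))

/-- LEV ∧ WT ∧ HC ⟹ CAP (composition along the ladder). -/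
theorem capture_of_cells (h₁ : LevelIsolation) (h₂ : WeightIsolation) (h₃ : HarishChandraCapture) : CaptureClassicality :=
  fun K _ _ n hcpt hn ℓ _ ι ρ hirr hgeo hC =>
    h₃ K n hcpt hn ℓ ι ρ hirr hgeo (h₂ K n hcpt hn ℓ ι ρ hirr hgeo (h₁ K n hcpt hn ℓ ι ρ hirr hgeo hC))

/-- **EXACT SPLIT of the translated target:** CAP ⟺ LEV ∧ WT ∧ HC. -/
theorem capture_iff_cells : CaptureClassicality ↔ LevelIsolation ∧ WeightIsolation ∧ HarishChandraCapture :=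
  ⟨fun h => ⟨lev_of_capture h, wt_of_capture h, hc_of_capture h⟩, fun h => capture_of_cells h.1 h.2.1 h.2.2⟩

/-- **EXACT SPLIT of the target BY NAME:** CLASS ⟺ LEV ∧ WT ∧ HC. -/
theorem classicality_iff_cells : DepthPrimeSplit.Classicality ↔ LevelIsolation ∧ WeightIsolation ∧ HarishChandraCapture :=
  classicality_iff_capture.trans capture_iff_cells

/-- each cell is necessary: CLASS ⟹ LEV. -/
theorem lev_of_classicality (h : DepthPrimeSplit.Classicality) : LevelIsolation :=
  (classicality_iff_cells.mp h).1

/-- CLASS ⟹ WT. -/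
theorem wt_of_classicality (h : DepthPrimeSplit.Classicality) : WeightIsolation :=
  (classicality_iff_cells.mp h).2.1

/-- CLASS ⟹ HC. -/
theorem hc_of_classicality (h : DepthPrimeSplit.Classicality) : HarishChandraCapture :=
  (classicality_iff_cells.mp h).2.2

/-! ## 5. ROOT-IMPLIED certificate (no EXCESS): the summit implies every piece -/

/-- `Langlands ⟹ B_w` (projection of direction (B); Fontaine's pinned datum by `rfl`). -/
private theorem weak_of_langlands (hL : _root_.Langlands) : PrimeSwitchSplit.WeakGeometricAutomorphy := by
  intro K _ _ n hcpt hn ℓ _ ι ρ hirr hgeo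
  obtain ⟨⟨Rec⟩, h⟩ := hL K
  obtain ⟨π, hπ, hcorr⟩ := (h Rec n hn hcpt).2 ℓ ι ρ hirr ⟨hgeo.1, fun v hv => hgeo.2 v hv⟩
  exact ⟨π, hπ, hcorr.1⟩

/-- `Langlands ⟹ CLASS` (the conclusion holds outright under B_w). -/
theorem classicality_of_langlands (hL : _root_.Langlands) : DepthPrimeSplit.Classicality :=
  fun K _ _ n hcpt hn ℓ _ ι ρ hirr hgeo _hC => weak_of_langlands hL K n hcpt hn ℓ ι ρ hirr hgeo

/-- `Langlands ⟹ LEV ∧ WT ∧ HC`. -/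
theorem cells_of_langlands (hL : _root_.Langlands) : LevelIsolation ∧ WeightIsolation ∧ HarishChandraCapture :=
  classicality_iff_cells.mp (classicality_of_langlands hL)

/-! ## 6. The frames BY NAME -/

/-- **closes (child on CLASS stmt-Langlands-25026):** LEV → WT → HC → `DepthPrimeSplit.Classicality`. -/
theorem closes_classicality (h₁ : LevelIsolation) (h₂ : WeightIsolation) (h₃ : HarishChandraCapture) : DepthPrimeSplit.Classicality :=
  classicality_iff_cells.mpr ⟨h₁, h₂, h₃⟩

/-- the optional assembly item, proved. -/
theorem boxAssembly_proof : BoxAssembly := closes_classicality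

/-- **closes_root:** the parent route's deciding theorem `DepthPrimeSplit.closes` with CLASS replaced by LEV, WT, HC. -/
theorem closes_root (hD : DepthPrimeSplit.DyadicSeed) (hO : DepthPrimeSplit.OddPrimeSeed) (hF : DepthPrimeSplit.FernSpread)
    (h₁ : LevelIsolation) (h₂ : WeightIsolation) (h₃ : HarishChandraCapture) (hW : DepthPrimeSplit.SatakeAvatarExistence)
    (hP : DepthPrimeSplit.PadicMemberCompatibility) (hA : DepthPrimeSplit.CompatibilityAwayFromLR)
    (hR : DepthPrimeSplit.CanonicalReciprocityData) : _root_.Langlands :=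
  DepthPrimeSplit.closes hD hO hF (closes_classicality h₁ h₂ h₃) hW hP hA hR

end Summit.Langlands.Langlands.Theorems.BoxCapture
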